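import Mathlib.GroupTheory.Index
import Mathlib.LinearAlgebra.FreeModule.IdealQuotient
import Mathlib.NumberTheory.NumberField.Basic
import Mathlib.RingTheory.DedekindDomain.IntegralClosure
import Literature.AlgebraicGeometry.ShimuraVarieties.HeckeCorrespondenceAction

/-!
# Stub `stub_finiteIndexHeckeLevel` (line `purity-sorted-hecke-envelope` / `HeckeGraphChow` of crux
# `EndoscopicMiddleDegree.OrthogonalEnveloped`, stmt-HodgeConjecture-14300): the Hecke level
# `N_g` of an isometry `g ∈ U(V)(F)` has finite index in `Γ`

Registered skeleton: `HeckeGraphChow` of crux `OrthogonalEnveloped`; this is the file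
`Theorems/EndoscopicMiddleDegreeOrthogonalEnvelopedFiniteIndexHeckeLevel.lean` of the summit
(`--supports stmt-HodgeConjecture-14300`).

WHAT IS PROVED. The arithmetic clause of the admissibility predicate `IsHeckeAdmissible g` of
`ShimuraVarieties/HeckeCorrespondenceAction`: for a compact ball quotient datum `D` (so
`Γ = D.Γ ≤ U(H)(E)` is a congruence subgroup: `Γ(n) ≤ Γ` with finite index for some `n ≥ 1`,
`Γ(n)` the principal congruence subgroup of level `n` of `U(H)(E)` for the standard lattice
`𝓞_E^{p+1}`) and every `g ∈ U(H)(E) = U(V)(F)`, the Hecke level `N_g` — the normal core in `Γ` of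
`Γ ∩ g⁻¹Γg` — has finite index in `Γ`; i.e. `U(V)(F)` commensurates `Γ` (Shimura 1971, §3.1 and
§3.2, Lemmas 3.9–3.10 for `GL_n(ℚ)` and `SL_n(ℤ)`; the same argument over `𝓞_E`).

Proof (Shimura's Lemma 3.9 over `𝓞_E`). Clear denominators: there is an integer `d ≥ 1` with `d g`
and `d g⁻¹` integral (`exists_integral_multiples`: every element of the number field `E` has a
non-zero integer multiple in `𝓞_E`). For `γ = 1 + n d² A ∈ Γ(n d²)` (`A` integral) one has
`g γ g⁻¹ = 1 + n (d g) A (d g⁻¹)` with `(d g) A (d g⁻¹)` integral, and likewise for `γ⁻¹`, so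
`g Γ(n d²) g⁻¹ ⊆ Γ(n) ⊆ Γ`, i.e. `Γ ∩ Γ(n d²) ⊆ Γ ∩ g⁻¹Γg` (`isCongruentOneMod_conj_of_nsmul`).
Finite index: `[Γ(n) : Γ(n) ∩ Γ(N)] < ∞` for every `N ≥ 1`
(`finiteIndex_subgroupOf_principalCongruenceSubgroup`): the elements of `Γ(n)` are integral
matrices, and two of them with the same reduction in the FINITE ring
`M_{p+1}(𝓞_E / N𝓞_E)` (`Ideal.finiteQuotientOfFreeOfNeBot`) differ by an element of `Γ(N)`
(`h⁻¹ h' = 1 + N h⁻¹ C` with `h⁻¹` integral), so `Γ(n) / (Γ(n) ∩ Γ(N))` injects into a finite set;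
then `[Γ : Γ ∩ Γ(n d²)] ≤ [Γ : Γ ∩ Γ(n)] · [Γ(n) : Γ(n) ∩ Γ(n d²)] < ∞`
(`Subgroup.relIndex_ne_zero_trans`), hence `[Γ : Γ ∩ g⁻¹Γg] < ∞` and the normal core of a
finite-index subgroup has finite index (`Subgroup.finiteIndex_normalCore`).

Sources: G. Shimura, *Introduction to the arithmetic theory of automorphic functions* (1971), §3.1
(commensurator, Prop. 3.1), §3.2 Lemma 3.9 (`Γ_{Nb} ⊂ β⁻¹Γ_Nβ ∩ βΓ_Nβ⁻¹`) and Lemma 3.10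
(`GL_n(ℚ)` commensurates `SL_n(ℤ)`); N. Bergeron, J. Millson, C. Moeglin, arXiv:1306.1515,
Introduction §1.1 (congruence subgroups `Γ = G(ℚ) ∩ K`).
-/

noncomputable section

-- The crux-workfile namespace `Summit.<P>.<Sub>.Cruxes.…` repeats `HodgeConjecture` (single-conjunct summit).
set_option linter.dupNamespace false

namespace Summit.HodgeConjecture.HodgeConjecture.Cruxes.OrthogonalEnveloped.HeckeGraphChow

open Literature.AlgebraicGeometry.Motives (SchemeOver)
open Literature.AlgebraicGeometry.ShimuraVarieties
open NumberField Matrix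

namespace FiniteIndexHeckeLevel

/-! ## Integral matrices: membership, integral representatives, conjugation (any field) -/

section Field

variable {E : Type*} [Field E] {m : Type*} [Fintype m] [DecidableEq m]

/-- Membership in the principal congruence subgroup `Γ(n)` of `U(H)(E)`: `g` is an isometry and
`g ≡ 1`, `g⁻¹ ≡ 1 (mod n)` integrally (unfolding of `principalCongruenceSubgroup`).
[cite: BergeronMillsonMoeglin2016Balls, Introduction §1.1] -/
theorem mem_principalCongruenceSubgroup_iff {σ : E →+* E} {H : Matrix m m E} {n : ℕ}
    {g : GL m E} :
    g ∈ principalCongruenceSubgroup σ H n ↔ g ∈ unitaryGroup σ H ∧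
      IsCongruentOneMod n (g : Matrix m m E) ∧
        IsCongruentOneMod n ((g⁻¹ : GL m E) : Matrix m m E) :=
  Iff.rfl

/-- A matrix `≡ 1 (mod n)` integrally, `g = 1 + n A` with `A ∈ M(𝓞_E)`, is an integral matrix:
`g = (1 + nA) ⊗ 1`. [cite: Shimura1973, §3.2 Lemma 3.9] -/
theorem exists_map_eq_of_isCongruentOneMod {n : ℕ} {M : Matrix m m E}
    (hM : IsCongruentOneMod n M) :
    ∃ B : Matrix m m (𝓞 E), M = B.map (algebraMap (𝓞 E) E) := by
  obtain ⟨A, rfl⟩ := hM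
  refine ⟨1 + n • A, ?_⟩
  change _ = (algebraMap (𝓞 E) E).mapMatrix (1 + n • A)
  rw [map_add, map_one, map_nsmul]
  rfl

omit [Fintype m] [DecidableEq m] in
/-- If `d · Mᵢⱼ` is integral over `ℤ` for all entries, then `d M` is an integral matrix.
[cite: Shimura1973, §3.2 Lemma 3.10] -/
theorem exists_map_eq_of_forall_isIntegral {d : ℕ} {M : Matrix m m E}
    (h : ∀ i j, IsIntegral ℤ ((d : E) * M i j)) :
    ∃ B : Matrix m m (𝓞 E), d • M = B.map (algebraMap (𝓞 E) E) :=
  ⟨Matrix.of fun i j => ⟨(d : E) * M i j, h i j⟩, by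
    ext i j
    rw [Matrix.smul_apply, Matrix.map_apply, Matrix.of_apply, nsmul_eq_mul, RingOfIntegers.map_mk]⟩

/-- **Shimura's Lemma 3.9 over `𝓞_E`.** If `γ ≡ 1 (mod n d²)` integrally, `d g` and `d g'` are
integral matrices and `g g' = 1`, then `g γ g' ≡ 1 (mod n)` integrally:
`g (1 + n d² A) g' = 1 + n · (d g) A (d g')`. [cite: Shimura1973, §3.2 Lemma 3.9] -/
theorem isCongruentOneMod_conj_of_nsmul
    {n d : ℕ} {g g' M : Matrix m m E} (hM : IsCongruentOneMod (n * (d * d)) M)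
    (hg : ∃ B : Matrix m m (𝓞 E), d • g = B.map (algebraMap (𝓞 E) E))
    (hg' : ∃ B' : Matrix m m (𝓞 E), d • g' = B'.map (algebraMap (𝓞 E) E))
    (hgg' : g * g' = 1) :
    IsCongruentOneMod n (g * M * g') := by
  obtain ⟨A, rfl⟩ := hM
  obtain ⟨B, hB⟩ := hg
  obtain ⟨B', hB'⟩ := hg'
  refine ⟨B * A * B', ?_⟩
  have key : g * ((n * (d * d)) • A.map (algebraMap (𝓞 E) E)) * g' =
      n • ((d • g) * A.map (algebraMap (𝓞 E) E) * (d • g')) := by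
    simp only [smul_mul_assoc, mul_smul_comm, smul_smul, mul_assoc]
  rw [mul_add, add_mul, mul_one, hgg', key, hB, hB']
  change _ = 1 + n • (algebraMap (𝓞 E) E).mapMatrix (B * A * B')
  rw [map_mul, map_mul]
  rfl

end Field

/-! ## Number fields: denominators and the finiteness of `[Γ(n) : Γ(n) ∩ Γ(N)]` -/

section NumberField

variable {E : Type*} [Field E] [NumberField E] {m : Type*} [Fintype m] [DecidableEq m]

/-- **Clearing denominators in a number field**: finitely many elements of `E = Frac 𝓞_E` have a
common denominator `d ∈ ℤ_{≥ 1}`, `d x ∈ 𝓞_E` (Mathlib's `exists_integral_multiples` over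
`ℤ ⊂ ℚ ⊂ E`, made positive). [cite: Shimura1973, §3.2 Lemma 3.10] -/
theorem exists_pos_forall_isIntegral_natCast_mul (s : Finset E) :
    ∃ d : ℕ, 0 < d ∧ ∀ x ∈ s, IsIntegral ℤ ((d : E) * x) := by
  obtain ⟨y, hy0, hint⟩ := exists_integral_multiples ℤ ℚ s
  obtain ⟨d, rfl | rfl⟩ := y.eq_nat_or_neg
  · refine ⟨d, Nat.pos_of_ne_zero fun h => hy0 (by rw [h, Nat.cast_zero]), fun x hx => ?_⟩
    have h := hint x hx
    rwa [Algebra.smul_def, map_natCast] at h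
  · refine ⟨d, Nat.pos_of_ne_zero fun h => hy0 (by rw [h, Nat.cast_zero, neg_zero]),
      fun x hx => ?_⟩
    have h := (hint x hx).neg
    rwa [Algebra.smul_def, map_neg, map_natCast, neg_mul, neg_neg] at h

/-- **`[Γ(n) : Γ(n) ∩ Γ(N)] < ∞` for `N ≥ 1`.** The elements of `Γ(n)` are integral matrices; two of
them with the same reduction in the finite ring `M_m(𝓞_E / N 𝓞_E)` differ (on either side) by an
element `h⁻¹h' = 1 + N h⁻¹C` of `Γ(N)`, so `Γ(n) / (Γ(n) ∩ Γ(N))` injects into a finite set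
(Shimura: `[Γ : Γ_b] < ∞`). [cite: Shimura1973, §3.2 Lemma 3.10] -/
theorem finiteIndex_subgroupOf_principalCongruenceSubgroup (σ : E →+* E) (H : Matrix m m E)
    (n : ℕ) {N : ℕ} (hN : N ≠ 0) :
    ((principalCongruenceSubgroup σ H N).subgroupOf
      (principalCongruenceSubgroup σ H n)).FiniteIndex := by
  classical
  set I : Ideal (𝓞 E) := Ideal.span {(N : 𝓞 E)} with hI
  haveI : Finite (𝓞 E ⧸ I) := Ideal.finiteQuotientOfFreeOfNeBot I (by
    rw [hI, Ne, Ideal.span_singleton_eq_bot]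
    exact_mod_cast hN)
  -- integral representatives of the elements of `Γ(n)`
  have hrep : ∀ h : ↥(principalCongruenceSubgroup σ H n), ∃ B : Matrix m m (𝓞 E),
      ((h : GL m E) : Matrix m m E) = B.map (algebraMap (𝓞 E) E) := fun h =>
    exists_map_eq_of_isCongruentOneMod (mem_principalCongruenceSubgroup_iff.1 h.2).2.1
  choose B hB using hrep
  -- same reduction mod `N` ⟹ `h'⁻¹ h ≡ 1 (mod N)`
  have hcong : ∀ h h' : ↥(principalCongruenceSubgroup σ H n),
      (B h).map (Ideal.Quotient.mk I) = (B h').map (Ideal.Quotient.mk I) →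
        IsCongruentOneMod N ((((h' : GL m E))⁻¹ * (h : GL m E) : GL m E) : Matrix m m E) := by
    intro h h' e
    have hentry : ∀ i j, ∃ c : 𝓞 E, B h i j = B h' i j + (N : 𝓞 E) * c := fun i j => by
      have hij := congr_fun (congr_fun e i) j
      rw [Matrix.map_apply, Matrix.map_apply, Ideal.Quotient.eq, hI,
        Ideal.mem_span_singleton'] at hij
      obtain ⟨c, hc⟩ := hij
      exact ⟨c, by rw [mul_comm, hc, add_sub_cancel]⟩
    choose C hC using hentry
    have hBB : B h = B h' + N • Matrix.of C := by
      ext i j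
      rw [Matrix.add_apply, Matrix.smul_apply, Matrix.of_apply, hC i j, nsmul_eq_mul]
    have hval : ((h : GL m E) : Matrix m m E) =
        ((h' : GL m E) : Matrix m m E) + N • (Matrix.of C).map (algebraMap (𝓞 E) E) := by
      rw [hB h, hB h', hBB]
      change (algebraMap (𝓞 E) E).mapMatrix (B h' + N • Matrix.of C) =
        (algebraMap (𝓞 E) E).mapMatrix (B h') + N • (algebraMap (𝓞 E) E).mapMatrix (Matrix.of C)
      rw [map_add, map_nsmul]
    obtain ⟨B', hB'⟩ :=
      exists_map_eq_of_isCongruentOneMod (mem_principalCongruenceSubgroup_iff.1 h'.2).2.2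
    refine ⟨B' * Matrix.of C, ?_⟩
    rw [Units.val_mul, hval, mul_add, Units.inv_mul, mul_smul_comm, hB']
    change _ = 1 + N • (algebraMap (𝓞 E) E).mapMatrix (B' * Matrix.of C)
    rw [map_mul]
    rfl
  -- the coset space injects into the finite set `M_m(𝓞_E / N)`
  haveI : Finite (↥(principalCongruenceSubgroup σ H n) ⧸
      (principalCongruenceSubgroup σ H N).subgroupOf (principalCongruenceSubgroup σ H n)) := by
    refine Finite.of_injective (fun q => (B q.out).map (Ideal.Quotient.mk I)) fun q q' e => ?_
    rw [← QuotientGroup.out_eq' q, ← QuotientGroup.out_eq' q', QuotientGroup.eq,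
      Subgroup.mem_subgroupOf, Subgroup.coe_mul, Subgroup.coe_inv,
      mem_principalCongruenceSubgroup_iff]
    refine ⟨mul_mem (inv_mem (mem_principalCongruenceSubgroup_iff.1 q.out.2).1)
      (mem_principalCongruenceSubgroup_iff.1 q'.out.2).1, hcong _ _ e.symm, ?_⟩
    rw [_root_.mul_inv_rev, inv_inv]
    exact hcong _ _ e
  exact Subgroup.finiteIndex_of_finite_quotient

end NumberField

end FiniteIndexHeckeLevel

/-! ## The registered stub -/

open FiniteIndexHeckeLevel in
/-- **Stub `stub_finiteIndexHeckeLevel` — `U(V)(F)` commensurates the congruence subgroup `Γ`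
(KNOWN: Shimura 1971, §3.1–§3.2, Lemmas 3.9–3.10; M).** For a compact ball quotient datum `D`
(`Γ = D.Γ` a congruence subgroup of `U(H)(E)`: `Γ(n) ≤ Γ` with finite index, `n ≥ 1`) and every
isometry `g ∈ U(H)(E)`, the Hecke level `N_g` (the normal core in `Γ` of `Γ ∩ g⁻¹Γg`) has finite
index in `Γ`. Proof: with `d ≥ 1` clearing the denominators of `g` and `g⁻¹`,
`g Γ(n d²) g⁻¹ ⊆ Γ(n) ⊆ Γ`, so `Γ ∩ Γ(n d²) ⊆ Γ ∩ g⁻¹Γg`; `[Γ : Γ ∩ Γ(n d²)] ≤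
[Γ : Γ ∩ Γ(n)] · [Γ(n) : Γ(n) ∩ Γ(n d²)] < ∞` (`𝓞_E / n d²` is finite); and the normal core of a
finite-index subgroup has finite index. [cite: Shimura1973, §3.2 Lemma 3.10] -/
theorem stub_finiteIndexHeckeLevel :
    ∀ {p : ℕ} {X : SchemeOver ℂ} (D : UnitaryBallQuotientDatum p X) (g : GL (Fin (p + 1)) D.E),
      g ∈ unitaryGroup (conjRingHom D.E) D.H → (D.heckeLevel g).FiniteIndex := by
  intro p X D g hg
  classical
  obtain ⟨-, n, hn, hPΓ, hfin⟩ := D.isCongruenceSubgroup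
  -- clear the denominators of `g` and `g⁻¹` simultaneously
  obtain ⟨d, hd, hint⟩ := exists_pos_forall_isIntegral_natCast_mul
    ((Finset.univ.image fun ij : Fin (p + 1) × Fin (p + 1) =>
        (g : Matrix (Fin (p + 1)) (Fin (p + 1)) D.E) ij.1 ij.2) ∪
      Finset.univ.image fun ij : Fin (p + 1) × Fin (p + 1) =>
        ((g⁻¹ : GL (Fin (p + 1)) D.E) : Matrix (Fin (p + 1)) (Fin (p + 1)) D.E) ij.1 ij.2)
  have hgint : ∃ B : Matrix (Fin (p + 1)) (Fin (p + 1)) (𝓞 D.E),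
      d • (g : Matrix (Fin (p + 1)) (Fin (p + 1)) D.E) = B.map (algebraMap (𝓞 D.E) D.E) :=
    exists_map_eq_of_forall_isIntegral fun i j => hint _
      (Finset.mem_union_left _ (Finset.mem_image.2 ⟨(i, j), Finset.mem_univ _, rfl⟩))
  have hginv : ∃ B' : Matrix (Fin (p + 1)) (Fin (p + 1)) (𝓞 D.E),
      d • ((g⁻¹ : GL (Fin (p + 1)) D.E) : Matrix (Fin (p + 1)) (Fin (p + 1)) D.E) =
        B'.map (algebraMap (𝓞 D.E) D.E) :=
    exists_map_eq_of_forall_isIntegral fun i j => hint _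
      (Finset.mem_union_right _ (Finset.mem_image.2 ⟨(i, j), Finset.mem_univ _, rfl⟩))
  -- `Γ ∩ Γ(n d²) ≤ Γ ∩ g⁻¹ Γ g`
  have hle : (principalCongruenceSubgroup (conjRingHom D.E) D.H (n * (d * d))).subgroupOf D.Γ ≤
      D.heckeStabilizer g := by
    intro γ hγ
    rw [Subgroup.mem_subgroupOf, mem_principalCongruenceSubgroup_iff] at hγ
    obtain ⟨hγU, hγ₁, hγ₂⟩ := hγ
    rw [UnitaryBallQuotientDatum.mem_heckeStabilizer_iff]
    refine hPΓ ?_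
    rw [mem_principalCongruenceSubgroup_iff]
    refine ⟨mul_mem (mul_mem hg hγU) (inv_mem hg), ?_, ?_⟩
    · rw [Units.val_mul, Units.val_mul]
      exact isCongruentOneMod_conj_of_nsmul hγ₁ hgint hginv (Units.mul_inv g)
    · have hrev : (g * (γ : GL (Fin (p + 1)) D.E) * g⁻¹)⁻¹ =
          g * (γ : GL (Fin (p + 1)) D.E)⁻¹ * g⁻¹ := by
        rw [_root_.mul_inv_rev, _root_.mul_inv_rev, inv_inv, mul_assoc]
      rw [hrev, Units.val_mul, Units.val_mul]
      exact isCongruentOneMod_conj_of_nsmul hγ₂ hgint hginv (Units.mul_inv g)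
  -- `[Γ : Γ ∩ Γ(n d²)] < ∞`
  have hidx : ((principalCongruenceSubgroup (conjRingHom D.E) D.H (n * (d * d))).subgroupOf
      D.Γ).FiniteIndex := by
    have h := finiteIndex_subgroupOf_principalCongruenceSubgroup (conjRingHom D.E) D.H n
      (N := n * (d * d)) (Nat.pos_iff_ne_zero.1 (Nat.mul_pos hn (Nat.mul_pos hd hd)))
    rw [← Subgroup.isFiniteRelIndex_iff_finiteIndex,
      Subgroup.isFiniteRelIndex_iff_relIndex_ne_zero] at hfin h ⊢
    exact Subgroup.relIndex_ne_zero_trans h hfin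
  haveI : (D.heckeStabilizer g).FiniteIndex := Subgroup.finiteIndex_of_le hle
  change (D.heckeStabilizer g).normalCore.FiniteIndex
  infer_instance

end Summit.HodgeConjecture.HodgeConjecture.Cruxes.OrthogonalEnveloped.HeckeGraphChow

end

-- ops-buildfix-3 (2026-08-22, B12-4): enqueue re-land so the lane rebuilds this module from current source (its 08-16/17 hub olean predates the 08-20 ShimuraVarieties packet rename and poisons importers); no content change.
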